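import Summits.CriticalPhenomena.CardyFormulaZ2.Theorems.CardyMeckeFlipLawToCrossingsDual
import Summits.CriticalPhenomena.CardyFormulaZ2.Theorems.CardyIKTransportCrudeToCanonical
import Summits.CriticalPhenomena.CardyFormulaZ2.Theorems.CardySelfRefinementLagHandOffQuadCompactness
import Literature.Probability.Percolation.QuadCrossingContinuityEventsProofs
import HarnessLib

/-!
# `LawToCrossings` (item stmt-CriticalPhenomena-14828, route `CardyMeckeFlip`): Cardy values of
# the subsequential quad-crossing limits give Cardy's formula for the crossing probabilities

Route `CardyMeckeFlip`, sub-problem `CardyFormulaZ2`, support item `LawToCrossings`: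
`SublimitsCardy → ∀ u → 0⁺, ∃ ψ, ∀ R (φ, x), bondDomainCrossingProb R (u (ψ k)) → F(crossRatio x)`.

Proof.  (1) `tendsto_prob_crude` — along a mesh sequence `δₙ → 0⁺` whose laws `μ_{δₙ}` on
Schramm–Smirnov's space `ℋ_ℂ` converge to `μ ∈ Λ`, the `P_{1/2}`-probability of the crude
crossing event of `R` (open path with vertices in `Ω` between the `√2 δ`-neighbourhoods of the arcs
`0`, `2`) tends to `F(η)`.  UPPER: the crude event forces the easier quad `Q_{1-s,1+s}` of `R` to be
crossed (`prob_crude_le_z2QuadLaw`), `⊞_{Q_{1-s,1+s}}` is closed so portmanteau bounds the limsup by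
`μ ⊞_{Q_{1-s,1+s}}`, which decreases to `μ ⊞_{Q_{1,1}} = F(η)` as `s ↓ 0` (measure continuity,
`exists_shrink_measure_crossedEvent_le`; `SublimitsCardy` at `R`).  LOWER: the harder quad
`Q⁺ = Q_{1+s,1-s}` crossed forces the crude event (`crossed_subset_crude`); `Q⁺` not crossed forces
the dual configuration — of law `P_{1/2}` again — to cross an easier transposed quad
(`prob_not_crossed_le_z2QuadLaw`), whose `μ`-probability decreases to `μ ⊞_{Qt} = F(1-η) = 1 - F(η)`
(`SublimitsCardy` at the re-marked rectangle, `cardyFunction_one_sub`).  No null-frontier input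
(Schramm–Smirnov's Lemma 5.1) is used.  (2) `tendsto_prob_crude_nhdsWithin` — every mesh sequence
has a subsequence along which the laws converge (`ℋ_ℂ` compact metrizable, Cor. 1.6:
`exists_mem_subseqQuadLimits_tendsto_subseq`), so the crude probability converges as `δ → 0⁺`;
rescaled by `√2` this is crude Cardy for `embDomainCrossing squareLatticeEmbedding.z`
(`hasCrossingLimit_crude`).  (3) The tree's `crudeToCanonical_proof` (item `CrudeToCanonical`,
Bollobás–Riordan's boundary sandwich on `ℤ²`) turns crude Cardy for every `R` into Cardy for G02's
`bondDomainCrossingProb`, and `LawToCrossings` follows with `ψ = id`.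

References: O. Schramm, S. Smirnov, Ann. Probab. 39 (2011), §1.3–1.4, Cor. 1.6; S. Smirnov,
C. R. Acad. Sci. Paris 333 (2001), §2; B. Bollobás, O. Riordan, *Percolation* (2006), Ch. 7.
-/

noncomputable section

open Set Filter MeasureTheory Metric Complex
open scoped Topology unitInterval ENNReal NNReal
open Literature.Probability.Percolation Literature.Probability.Percolation.QuadCrossing
open Literature.Probability.RandomPlanarGeometry Literature.Probability.LatticeModels
open Summit.CriticalPhenomena.CardyFormulaZ2.Theses.CardyMeckeFlip
open Summit.CriticalPhenomena.CardyFormulaZ2.Cruxes.LagHandOff.CrosscutDictionary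

namespace Summit.CriticalPhenomena.CardyFormulaZ2.Theorems.MeckeFlipBridge

/-- `1 - ofReal (1 - F) = ofReal F` for `F ∈ [0, 1]`. -/
theorem one_sub_ofReal_one_sub {F : ℝ} (hF : F ≤ 1) :
    1 - ENNReal.ofReal (1 - F) = ENNReal.ofReal F := by
  rw [← ENNReal.ofReal_one, ← ENNReal.ofReal_sub 1 (by linarith : 0 ≤ 1 - F)]
  congr 1
  ring

section SquareModel

variable {R : ConformalRectangle} {Φ : ℂ ≃ₜ ℂ} (h : IsSquareModel R Φ)
include h

/-- **Upper half along a convergent mesh sequence**: `limsup P[crude] ≤ F(η)`.  The crude event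
forces the easier quad `Q_{1-s,1+s}` of `R` to be crossed, `⊞_{Q_{1-s,1+s}}` is closed so
portmanteau bounds the limsup by `μ ⊞_{Q_{1-s,1+s}}`, which is within `ε` of `μ ⊞_{Q_{1,1}} = F(η)`
for small `s`. -/
theorem limsup_prob_crude_le (hT : SublimitsCardy)
    {φ : ConformalEquiv UpperHalfPlane.upperHalfPlaneSet R.carrier} {x : Fin 4 → ℝ}
    (hφ : R.IsUniformizing φ x) {δ : ℕ → ℝ} (hδ : ∀ n, 0 < δ n) (hδ0 : Tendsto δ atTop (𝓝 0))
    {μ : FiniteMeasure (QuadConfig (univ : Set ℂ))} (hμ : μ ∈ subseqQuadLimits (univ : Set ℂ))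
    (hlim : Tendsto (fun n => z2QuadLaw (univ : Set ℂ) (δ n)) atTop (𝓝 μ)) :
    limsup (fun n => bondPercolation (zdGraph 2) half
      (openCrossing {y : Site 2 | meshPoint (δ n) y ∈ R.carrier}
        {u | infDist (meshPoint (δ n) u) (R.arc 0) ≤ Real.sqrt 2 * δ n}
        {v | infDist (meshPoint (δ n) v) (R.arc 2) ≤ Real.sqrt 2 * δ n})) atTop ≤
      ENNReal.ofReal (Literature.Probability.RandomPlanarGeometry.cardyFunction (crossRatio x)) := by
  haveI : HasOuterApproxClosed (QuadConfig (univ : Set ℂ)) :=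
    QuadConfig.hasOuterApproxClosed isOpen_univ univ_nonempty
  have h22 : Real.sqrt 2 ≤ 2 := Real.sqrt_two_lt_three_halves.le.trans (by norm_num)
  refine ENNReal.le_of_forall_pos_le_add fun ε hε _ => ?_
  obtain ⟨s, hs, hs', hμs⟩ := exists_shrink_measure_crossedEvent_le
    ((Homeomorph.mulLeft₀ Complex.I Complex.I_ne_zero).trans Φ)
    (μ : Measure (QuadConfig (univ : Set ℂ))) (ENNReal.coe_pos.2 hε)
  obtain ⟨δ₀, hδ₀, hle⟩ := prob_crude_le_z2QuadLaw h hs hs'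
  have hev : ∀ᶠ n in atTop, δ n < δ₀ := (hδ0.eventually (Iio_mem_nhds hδ₀)).mono fun n hn => hn
  have hq1 : (0 : ℝ) < 1 - s := by linarith
  have hq2 : (0 : ℝ) < 1 + s := by linarith
  have hstep : ∀ᶠ n in atTop, bondPercolation (zdGraph 2) half
      (openCrossing {y : Site 2 | meshPoint (δ n) y ∈ R.carrier}
        {u | infDist (meshPoint (δ n) u) (R.arc 0) ≤ Real.sqrt 2 * δ n}
        {v | infDist (meshPoint (δ n) v) (R.arc 2) ≤ Real.sqrt 2 * δ n}) ≤
      (z2QuadLaw (univ : Set ℂ) (δ n) : Measure (QuadConfig (univ : Set ℂ)))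
        (QuadConfig.crossedEvent (Quad.rectQuad
          ((Homeomorph.mulLeft₀ Complex.I Complex.I_ne_zero).trans Φ) (1 - s) (1 + s)
          hq1 hq2 (fun _ => mem_univ _))) := by
    filter_upwards [hev] with n hn
    refine (measure_mono (Literature.Probability.Percolation.openCrossing_mono Subset.rfl ?_ ?_)).trans (hle (δ n) (hδ n) hn)
    · exact fun u hu => le_trans (b := Real.sqrt 2 * δ n) hu
        (mul_le_mul_of_nonneg_right h22 (hδ n).le)
    · exact fun v hv => le_trans (b := Real.sqrt 2 * δ n) hv
        (mul_le_mul_of_nonneg_right h22 (hδ n).le)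
  calc _ ≤ limsup (fun n => (z2QuadLaw (univ : Set ℂ) (δ n) : Measure (QuadConfig (univ : Set ℂ)))
        (QuadConfig.crossedEvent (Quad.rectQuad
          ((Homeomorph.mulLeft₀ Complex.I Complex.I_ne_zero).trans Φ) (1 - s) (1 + s)
          hq1 hq2 (fun _ => mem_univ _)))) atTop := limsup_le_limsup hstep
    _ ≤ (μ : Measure (QuadConfig (univ : Set ℂ))) (QuadConfig.crossedEvent (Quad.rectQuad
          ((Homeomorph.mulLeft₀ Complex.I Complex.I_ne_zero).trans Φ) (1 - s) (1 + s)
          hq1 hq2 (fun _ => mem_univ _))) :=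
        FiniteMeasure.limsup_measure_closed_le_of_tendsto hlim (QuadConfig.isClosed_crossedEvent _)
    _ ≤ (μ : Measure (QuadConfig (univ : Set ℂ))) (QuadConfig.crossedEvent (Quad.rectQuad
          ((Homeomorph.mulLeft₀ Complex.I Complex.I_ne_zero).trans Φ) 1 1 one_pos one_pos
          (fun _ => mem_univ _))) + ε := hμs
    _ = _ := by rw [measure_crossedEvent_quadOf hT hμ h hφ]

/-- **Lower half along a convergent mesh sequence**: `F(η) ≤ liminf P[crude]`.  The harder quad
`Q⁺` crossed forces the crude event; `Q⁺` not crossed forces the dual configuration (of law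
`P_{1/2}`) to cross an easier transposed quad, whose closed crossing event has `μ`-probability within
`ε` of `μ ⊞_{Qt} = 1 - F(η)`. -/
theorem le_liminf_prob_crude (hT : SublimitsCardy)
    {φ : ConformalEquiv UpperHalfPlane.upperHalfPlaneSet R.carrier} {x : Fin 4 → ℝ}
    (hφ : R.IsUniformizing φ x) {δ : ℕ → ℝ} (hδ : ∀ n, 0 < δ n) (hδ0 : Tendsto δ atTop (𝓝 0))
    {μ : FiniteMeasure (QuadConfig (univ : Set ℂ))} (hμ : μ ∈ subseqQuadLimits (univ : Set ℂ))
    (hlim : Tendsto (fun n => z2QuadLaw (univ : Set ℂ) (δ n)) atTop (𝓝 μ)) :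
    ENNReal.ofReal (Literature.Probability.RandomPlanarGeometry.cardyFunction (crossRatio x)) ≤
    liminf (fun n => bondPercolation (zdGraph 2) half
      (openCrossing {y : Site 2 | meshPoint (δ n) y ∈ R.carrier}
        {u | infDist (meshPoint (δ n) u) (R.arc 0) ≤ Real.sqrt 2 * δ n}
        {v | infDist (meshPoint (δ n) v) (R.arc 2) ≤ Real.sqrt 2 * δ n})) atTop := by
  haveI : HasOuterApproxClosed (QuadConfig (univ : Set ℂ)) :=
    QuadConfig.hasOuterApproxClosed isOpen_univ univ_nonempty
  have hF1 : Literature.Probability.RandomPlanarGeometry.cardyFunction (crossRatio x) ≤ 1 :=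
    (cardyFunction_mem_Icc_holds
      (Ioo_subset_Icc_self (ConformalRectangle.crossRatio_mem_Ioo_of_isUniformizing hφ))).2
  have h12 : (1 : ℝ) ≤ Real.sqrt 2 := Real.one_lt_sqrt_two.le
  refine ENNReal.le_of_forall_pos_le_add fun ε hε _ => ?_
  obtain ⟨t, ht, ht', hμt⟩ := exists_shrink_measure_crossedEvent_le Φ
    (μ : Measure (QuadConfig (univ : Set ℂ))) (ENNReal.coe_pos.2 hε)
  have hs : 0 < t / 4 := by positivity
  have hs' : t / 4 ≤ 1 / 2 := by linarith
  obtain ⟨δ₀, hδ₀, hle⟩ := prob_not_crossed_le_z2QuadLaw Φ hs hs' hs hs'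
  obtain ⟨δ₁, hδ₁, hincl⟩ := crossed_subset_crude h hs hs'
  have hev₀ : ∀ᶠ n in atTop, δ n < δ₀ := (hδ0.eventually (Iio_mem_nhds hδ₀)).mono fun n hn => hn
  have hev₁ : ∀ᶠ n in atTop, δ n < δ₁ := (hδ0.eventually (Iio_mem_nhds hδ₁)).mono fun n hn => hn
  -- positivity facts, named once so that every occurrence of the quads below is syntactically equal
  have hp1 : (0 : ℝ) < (1 - t / 4) * (1 - t / 4) := mul_pos (by linarith) (by linarith)
  have hp2 : (0 : ℝ) < (1 + t / 4) * (1 + t / 4) := mul_pos (by linarith) (by linarith)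
  have hq1 : (0 : ℝ) < 1 - t := by linarith
  have hq2 : (0 : ℝ) < 1 + t := by linarith
  have hr1 : (0 : ℝ) < 1 + t / 4 := by linarith
  have hr2 : (0 : ℝ) < 1 - t / 4 := by linarith
  -- the easier transposed quad `Qt_{a,b}` is harder than `Qt_{1-t,1+t}`
  have hdom : Quad.StrictlyDominated
      (Quad.rectQuad (D := (univ : Set ℂ)) Φ (1 - t) (1 + t) hq1 hq2 (fun _ => mem_univ _))
      (Quad.rectQuad (D := (univ : Set ℂ)) Φ ((1 - t / 4) * (1 - t / 4)) ((1 + t / 4) * (1 + t / 4))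
        hp1 hp2 (fun _ => mem_univ _)) :=
    Quad.strictlyDominated_rectQuad Φ hq1 (by nlinarith) hp2 (by nlinarith) _ _
  have hsub := QuadConfig.crossedEvent_subset_of_strictlyDominated hdom
  -- (i) `1 - P[Q⁺ ∉ S_ω] ≤ P[crude]` eventually
  have hab : ∀ᶠ n in atTop, 1 - bondPercolation (zdGraph 2) half
      {ω | Quad.rectQuad ((Homeomorph.mulLeft₀ Complex.I Complex.I_ne_zero).trans Φ) (1 + t / 4)
        (1 - t / 4) hr1 hr2 (fun _ => mem_univ _) ∉ z2QuadConfig univ (δ n) ω} ≤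
      bondPercolation (zdGraph 2) half
      (openCrossing {y : Site 2 | meshPoint (δ n) y ∈ R.carrier}
        {u | infDist (meshPoint (δ n) u) (R.arc 0) ≤ Real.sqrt 2 * δ n}
        {v | infDist (meshPoint (δ n) v) (R.arc 2) ≤ Real.sqrt 2 * δ n}) := by
    filter_upwards [hev₁] with n hn
    have hmeas : MeasurableSet {ω | Quad.rectQuad ((Homeomorph.mulLeft₀ Complex.I
        Complex.I_ne_zero).trans Φ) (1 + t / 4) (1 - t / 4) hr1 hr2
        (fun _ => mem_univ _) ∉ z2QuadConfig univ (δ n) ω} :=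
      ((measurable_z2QuadConfig isOpen_univ (hδ n)) (QuadConfig.measurableSet_crossedEvent _)).compl
    rw [← prob_compl_eq_one_sub hmeas]
    refine measure_mono fun ω hω => ?_
    have hω' : Quad.rectQuad ((Homeomorph.mulLeft₀ Complex.I Complex.I_ne_zero).trans Φ) (1 + t / 4)
        (1 - t / 4) hr1 hr2 (fun _ => mem_univ _) ∈ z2QuadConfig univ (δ n) ω :=
      not_not.1 hω
    refine Literature.Probability.Percolation.openCrossing_mono Subset.rfl ?_ ?_ (hincl (δ n) (hδ n) hn ω hω')
    · exact fun u hu => le_trans (b := δ n) hu (le_mul_of_one_le_left (hδ n).le h12)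
    · exact fun v hv => le_trans (b := δ n) hv (le_mul_of_one_le_left (hδ n).le h12)
  -- (ii) `limsup P[Q⁺ ∉ S_ω] ≤ μ ⊞_{Qt} + ε`
  have hb : limsup (fun n => bondPercolation (zdGraph 2) half
      {ω | Quad.rectQuad ((Homeomorph.mulLeft₀ Complex.I Complex.I_ne_zero).trans Φ) (1 + t / 4)
        (1 - t / 4) hr1 hr2 (fun _ => mem_univ _) ∉ z2QuadConfig univ (δ n) ω})
      atTop ≤
      (μ : Measure (QuadConfig (univ : Set ℂ))) (QuadConfig.crossedEvent
        (Quad.rectQuad (D := (univ : Set ℂ)) Φ 1 1 one_pos one_pos (fun _ => mem_univ _))) + ε :=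
    calc _ ≤ limsup (fun n => (z2QuadLaw (univ : Set ℂ) (δ n) : Measure (QuadConfig (univ : Set ℂ)))
            (QuadConfig.crossedEvent (Quad.rectQuad (D := (univ : Set ℂ)) Φ
              ((1 - t / 4) * (1 - t / 4)) ((1 + t / 4) * (1 + t / 4)) hp1 hp2
              (fun _ => mem_univ _)))) atTop :=
          limsup_le_limsup (hev₀.mono fun n hn => hle (δ n) (hδ n) hn)
      _ ≤ (μ : Measure (QuadConfig (univ : Set ℂ))) (QuadConfig.crossedEvent (Quad.rectQuad
            (D := (univ : Set ℂ)) Φ ((1 - t / 4) * (1 - t / 4)) ((1 + t / 4) * (1 + t / 4))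
            hp1 hp2 (fun _ => mem_univ _))) :=
          FiniteMeasure.limsup_measure_closed_le_of_tendsto hlim (QuadConfig.isClosed_crossedEvent _)
      _ ≤ (μ : Measure (QuadConfig (univ : Set ℂ))) (QuadConfig.crossedEvent (Quad.rectQuad
            (D := (univ : Set ℂ)) Φ (1 - t) (1 + t) hq1 hq2 (fun _ => mem_univ _))) :=
          measure_mono hsub
      _ ≤ _ := hμt
  -- (iii) assemble in `ℝ≥0∞`
  have h1 := liminf_le_liminf hab
  rw [ENNReal.liminf_const_sub atTop _ ENNReal.one_ne_top] at h1
  have h2 := tsub_le_tsub_left hb 1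
  rw [measure_crossedEvent_transposeOf hT hμ h hφ, ← tsub_tsub, one_sub_ofReal_one_sub hF1] at h2
  calc _ ≤ ENNReal.ofReal (Literature.Probability.RandomPlanarGeometry.cardyFunction (crossRatio x)) -
        ε + ε := le_tsub_add
    _ ≤ _ := add_le_add (h2.trans h1) le_rfl

/-- **The crude crossing probability along a convergent mesh sequence** tends to `F(crossRatio x)`
(`le_liminf_prob_crude`, `limsup_prob_crude_le`). -/
theorem tendsto_prob_crude (hT : SublimitsCardy)
    {φ : ConformalEquiv UpperHalfPlane.upperHalfPlaneSet R.carrier} {x : Fin 4 → ℝ}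
    (hφ : R.IsUniformizing φ x) {δ : ℕ → ℝ} (hδ : ∀ n, 0 < δ n) (hδ0 : Tendsto δ atTop (𝓝 0))
    {μ : FiniteMeasure (QuadConfig (univ : Set ℂ))} (hμ : μ ∈ subseqQuadLimits (univ : Set ℂ))
    (hlim : Tendsto (fun n => z2QuadLaw (univ : Set ℂ) (δ n)) atTop (𝓝 μ)) :
    Tendsto (fun n => bondPercolation (zdGraph 2) half
      (openCrossing {y : Site 2 | meshPoint (δ n) y ∈ R.carrier}
        {u | infDist (meshPoint (δ n) u) (R.arc 0) ≤ Real.sqrt 2 * δ n}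
        {v | infDist (meshPoint (δ n) v) (R.arc 2) ≤ Real.sqrt 2 * δ n})) atTop
      (𝓝 (ENNReal.ofReal (Literature.Probability.RandomPlanarGeometry.cardyFunction (crossRatio x)))) :=
  tendsto_of_le_liminf_of_limsup_le (le_liminf_prob_crude h hT hφ hδ hδ0 hμ hlim)
    (limsup_prob_crude_le h hT hφ hδ hδ0 hμ hlim)

/-- **The crude crossing probability converges as `δ → 0⁺`** (under `SublimitsCardy`): every mesh
sequence has a subsequence along which the laws `μ_δ` converge in `ℋ_ℂ` (compactness, Schramm–Smirnov
Cor. 1.6), and along it the crude probability tends to `F(η)` by `tendsto_prob_crude`. -/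
theorem tendsto_prob_crude_nhdsWithin (hT : SublimitsCardy)
    {φ : ConformalEquiv UpperHalfPlane.upperHalfPlaneSet R.carrier} {x : Fin 4 → ℝ}
    (hφ : R.IsUniformizing φ x) :
    Tendsto (fun δ : ℝ => (bondPercolation (zdGraph 2) half
      (openCrossing {y : Site 2 | meshPoint δ y ∈ R.carrier}
        {u | infDist (meshPoint δ u) (R.arc 0) ≤ Real.sqrt 2 * δ}
        {v | infDist (meshPoint δ v) (R.arc 2) ≤ Real.sqrt 2 * δ})).toReal) (𝓝[>] 0)
      (𝓝 (Literature.Probability.RandomPlanarGeometry.cardyFunction (crossRatio x))) := by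
  have hF0 : 0 ≤ Literature.Probability.RandomPlanarGeometry.cardyFunction (crossRatio x) :=
    (cardyFunction_mem_Icc_holds
      (Ioo_subset_Icc_self (ConformalRectangle.crossRatio_mem_Ioo_of_isUniformizing hφ))).1
  refine tendsto_of_subseq_tendsto fun ns hns => ?_
  rw [tendsto_nhdsWithin_iff] at hns
  obtain ⟨hns0, hpos⟩ := hns
  obtain ⟨N, hN⟩ := eventually_atTop.1 hpos
  have hns'pos : ∀ n, 0 < ns (n + N) := fun n => hN _ (Nat.le_add_left N n)
  have hns'0 : Tendsto (fun n => ns (n + N)) atTop (𝓝 0) := hns0.comp (tendsto_add_atTop_nat N)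
  obtain ⟨φs, hφs, μ, hμ, hlim⟩ :=
    exists_mem_subseqQuadLimits_tendsto_subseq (fun n => ns (n + N)) hns'pos hns'0
  refine ⟨fun n => φs n + N, ?_⟩
  have ht := tendsto_prob_crude h hT hφ (δ := fun n => ns (φs n + N)) (fun n => hns'pos _)
    (hns'0.comp hφs.tendsto_atTop) hμ hlim
  have := (ENNReal.tendsto_toReal ENNReal.ofReal_ne_top).comp ht
  rw [ENNReal.toReal_ofReal hF0] at this
  exact this

end SquareModel

/-- `δ ↦ √2 δ` maps `δ → 0⁺` to `δ → 0⁺`. -/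
theorem tendsto_mul_sqrt_two :
    Tendsto (fun δ : ℝ => δ * Real.sqrt 2) (𝓝[>] 0) (𝓝[>] 0) := by
  refine tendsto_nhdsWithin_iff.2 ⟨?_, ?_⟩
  · have h : Tendsto (fun δ : ℝ => δ * Real.sqrt 2) (𝓝 0) (𝓝 (0 * Real.sqrt 2)) :=
      tendsto_id.mul_const _
    rw [zero_mul] at h
    exact h.mono_left nhdsWithin_le_nhds
  · filter_upwards [self_mem_nhdsWithin] with δ hδ
    exact mul_pos hδ (Real.sqrt_pos.2 two_pos)

/-- **Crude Cardy on `ℤ²` from `SublimitsCardy`.**  For every conformal rectangle `R`, the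
`P_{1/2}`-probability of the crude embedded crossing event
`embDomainCrossing squareLatticeEmbedding.z R.carrier δ (R.arc 0) (R.arc 2)` tends to `F(η_R)` as
`δ → 0⁺` — the hypothesis of the tree's `CrudeToCanonical`. -/
theorem hasCrossingLimit_crude (hT : SublimitsCardy) (R : ConformalRectangle) :
    R.HasCrossingLimit (fun δ ↦ (bondPercolation (zdGraph 2) half).real
      (embDomainCrossing squareLatticeEmbedding.z R.carrier δ (R.arc 0) (R.arc 2)))
      Literature.Probability.RandomPlanarGeometry.cardyFunction := by
  intro φ x hφ
  obtain ⟨Φ, h⟩ := exists_isSquareModel R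
  have key := (tendsto_prob_crude_nhdsWithin h hT hφ).comp tendsto_mul_sqrt_two
  refine key.congr fun δ => ?_
  have hne : Real.sqrt 2 ≠ 0 := Real.sqrt_ne_zero'.2 two_pos
  have hδ : δ = δ * Real.sqrt 2 / Real.sqrt 2 := (mul_div_cancel_right₀ δ hne).symm
  simp only [Function.comp_apply, measureReal_def]
  conv_rhs => rw [hδ, embDomainCrossing_div_sqrt_two]

end MeckeFlipBridge

/-- **`LawToCrossings` (item stmt-CriticalPhenomena-14828).**  If every subsequential quad-crossing
scaling limit of critical bond percolation on `ℤ²` gives every quad of a conformal rectangle its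
Cardy value (`SublimitsCardy`), then for every mesh sequence `u → 0⁺` there is a subsequence (here:
the sequence itself) along which G02's crossing probabilities `bondDomainCrossingProb R (u k)`
converge to `F(crossRatio x)` for every conformal rectangle `R` and uniformizing datum `(φ, x)`:
crude Cardy for every `R` (`hasCrossingLimit_crude`) and the tree's boundary sandwich
`crudeToCanonical_proof`. -/
theorem lawToCrossings_proof : LawToCrossings := by
  intro hT u hu
  have hbond := crudeToCanonical_proof (MeckeFlipBridge.hasCrossingLimit_crude hT)
  exact ⟨id, strictMono_id, fun R φ x hφ => (hbond R φ x hφ).comp hu⟩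

end Summit.CriticalPhenomena.CardyFormulaZ2.Theorems

end
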